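import Summits.HubbardSuperconductivity.HubbardSuperconductivity.Theorems.AnisotropyChordTransferFibre3KernelDiffLemmas

/-!
# Route `AnisotropyChord` / H0 rotor rung: the FIRST-DIFFERENCE ESTIMATE `Σ_n |h_r(n + eₓ) − h_r(n)| ≤ (10K·N + π²/2)·|r|²` for the torus kernel symbol at `λ = 0`

Fourth file of the periodisation toolkit (memo ROTOR-THEORY-21 §320–§322).  With `h_r(n) = g(n)(1 − Re φ_n(r))`, `g(n) = 1/(2ε(n))`
off the origin (`hfun`), on the torus `(ℤ/N)²`, for integer `r = (x, y)`, `ρ = x² + y²`, `K = π²/2 + π⁴/4`: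
* `hfun_eq`, `hfun_zero`, `u_bounds` (`0 ≤ 1 − Re φ_n(r) ≤ θ²·l1(n)²·ρ/2`), `hfun_le` (`0 ≤ h_r(n) ≤ π²ρ/4`);
* ★ `abs_hfun_sub_le` — POINTWISE: `|h_r(n+eₓ) − h_r(n)| ≤ K·ρ·(l1(n) + ½)/l1(n+eₓ)²` for `n, n+eₓ ≠ 0` (via `quotient_diff_bound`);
* `ring_l1_ge`, ★ `sum_inv_l1_le` (`Σ_{0<|m|∞≤K} 1/(|m₁|+|m₂|) ≤ 8K`), `invl1`, `sum_invl1_le` (`Σ_n 1/l1(n) ≤ 4N`, representatives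
  inject into the punctured box, p2 g0's `rep_injective`/`rep_mem_box`);
* `abs_hfun_sub_le_all` (edge cases folded in), ★★ `sum_abs_hfun_sub_le`: `Σ_n |h_r(n + eₓ) − h_r(n)| ≤ (10K·N + π²/2)·ρ`.
Prover seat `hubbard-h0-rotor-p2` g2; helper for stmt-HubbardSuperconductivity-19089 (`--supports`, helper class).
WHAT THIS IS NOT: nothing here proves superconductivity in the Hubbard model; the rotor TARGET as originally worded stays
FALSE (g15 verdict).  Elementary estimates serving ONE analytic input (periodisation) of ONE input (HOLE₂) of ONE conditional
reduction (rung 19089); constants are crude (structural, not numerically useful).  Mathlib + tree imports only; no sorry, no axioms.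
-/

set_option linter.dupNamespace false

noncomputable section

open scoped BigOperators
open Complex Finset

namespace Summit.HubbardSuperconductivity.HubbardSuperconductivity.Theorems.AnisotropyChord.Transfer.Fibre3

namespace Subsample

variable (N : ℕ) [NeZero N]

/-! ## The pointwise first-difference bound at `λ = 0` -/

/-- `h_r(n) = g(n)(1 − Re φ_n(r))` at `λ = 0`. [folklore] -/
def hfun (r n : Tor N) : ℝ := gres N 0 n * (1 - (phase N n r).re)

/-- `2ε(n) > 0` off the origin. [folklore] -/
theorem two_epsT_pos {n : Tor N} (hn : n ≠ 0) : 0 < 2 * epsT N n := by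
  have h := two_epsT_ge_l1 N n
  have ha := one_le_l1 N hn
  have hθ : 0 < 2 / Real.pi ^ 2 * (2 * Real.pi / N) ^ 2 * l1 N n ^ 2 := by
    have hN : (0 : ℝ) < N := by exact_mod_cast Nat.pos_of_ne_zero (NeZero.ne N)
    have : 0 < l1 N n := by linarith
    positivity
  linarith

omit [NeZero N] in
/-- off the origin `h_r(n) = (1 − Re φ_n(r)) / (2ε(n))`. [folklore] -/
theorem hfun_eq {n : Tor N} (hn : n ≠ 0) (r : Tor N) : hfun N r n = (1 - (phase N n r).re) / (2 * epsT N n) := by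
  unfold hfun gres
  rw [if_neg hn, sub_zero]
  ring

omit [NeZero N] in
/-- `h_r(0) = 0`. [folklore] -/
theorem hfun_zero (r : Tor N) : hfun N r 0 = 0 := by unfold hfun gres; simp

/-- the momentum-independent numerator bound `0 ≤ 1 − Re φ_n(r) ≤ θ²·l1(n)²·ρ/2`. [folklore] -/
theorem u_bounds (n : Tor N) (x y : ℤ) :
    0 ≤ 1 - (phase N n (((x : ℤ) : ZMod N), ((y : ℤ) : ZMod N))).re ∧
    1 - (phase N n (((x : ℤ) : ZMod N), ((y : ℤ) : ZMod N))).re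
      ≤ (2 * Real.pi / N) ^ 2 * l1 N n ^ 2 * ((x : ℝ) ^ 2 + (y : ℝ) ^ 2) / 2 := by
  rw [re_phase_rep]
  refine ⟨by have := Real.cos_le_one (2 * Real.pi / N * ((n.1.valMinAbs * x + n.2.valMinAbs * y : ℤ) : ℝ)); linarith, ?_⟩
  have hcos := Real.one_sub_sq_div_two_le_cos (x := 2 * Real.pi / N * ((n.1.valMinAbs * x + n.2.valMinAbs * y : ℤ) : ℝ))
  refine (show _ ≤ (2 * Real.pi / N * ((n.1.valMinAbs * x + n.2.valMinAbs * y : ℤ) : ℝ)) ^ 2 / 2 by linarith).trans ?_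
  rw [mul_pow]
  have := dot_sq_le N n x y
  have hθ : 0 ≤ (2 * Real.pi / N) ^ 2 := by positivity
  nlinarith [mul_le_mul_of_nonneg_left this hθ]

/-- ★ **POINTWISE FIRST-DIFFERENCE BOUND** (`λ = 0`, both momenta off the origin):
`|h_r(n + eₓ) − h_r(n)| ≤ (π²/2 + π⁴/4)·ρ·(l1(n) + ½)/l1(n + eₓ)²`, `ρ = x² + y²`. [folklore] -/
theorem abs_hfun_sub_le (x y : ℤ) {n : Tor N} (hn : n ≠ 0) (hn' : n + ex N ≠ 0) :
    |hfun N (((x : ℤ) : ZMod N), ((y : ℤ) : ZMod N)) (n + ex N) - hfun N (((x : ℤ) : ZMod N), ((y : ℤ) : ZMod N)) n|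
      ≤ (Real.pi ^ 2 / 2 + Real.pi ^ 4 / 4)
        * (((x : ℝ) ^ 2 + (y : ℝ) ^ 2) * (l1 N n + 1 / 2) / l1 N (n + ex N) ^ 2) := by
  set r : Tor N := (((x : ℤ) : ZMod N), ((y : ℤ) : ZMod N)) with hr
  set θ : ℝ := 2 * Real.pi / N with hθ
  have hN : (0 : ℝ) < N := by exact_mod_cast Nat.pos_of_ne_zero (NeZero.ne N)
  have hθpos : 0 < θ := by rw [hθ]; positivity
  rw [hfun_eq N hn', hfun_eq N hn]
  -- the constant
  have hK : Real.pi ^ 2 / 2 + Real.pi ^ 4 / 4 = 1 / (2 / Real.pi ^ 2) + 1 / (2 / Real.pi ^ 2) ^ 2 := by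
    field_simp; ring
  rw [hK]
  -- the data of the abstract estimate
  obtain ⟨hu0, hu⟩ := u_bounds N n x y
  have hv := two_epsT_ge_l1 N n
  have hv' := two_epsT_ge_l1 N (n + ex N)
  -- |Δu|
  have hA' : ((((n + ex N).1.valMinAbs * x + (n + ex N).2.valMinAbs * y : ℤ)) : ZMod N)
      = (((n.1.valMinAbs * x + n.2.valMinAbs * y + x : ℤ)) : ZMod N) := by
    have h1 := rep_succ_congr N n
    have h2 : (n + ex N).2 = n.2 := by simp [ex]
    push_cast at h1 ⊢
    rw [h2, h1]
    ring
  have hdu : |(1 - (phase N (n + ex N) r).re) - (1 - (phase N n r).re)|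
      ≤ θ ^ 2 * ((x : ℝ) ^ 2 + (y : ℝ) ^ 2) * (l1 N n + 1 / 2) := by
    rw [hr, re_phase_rep, re_phase_rep, cos_theta_congr N hA', ← hθ]
    rw [show (1 - Real.cos (θ * ((n.1.valMinAbs * x + n.2.valMinAbs * y + x : ℤ) : ℝ)))
        - (1 - Real.cos (θ * ((n.1.valMinAbs * x + n.2.valMinAbs * y : ℤ) : ℝ)))
        = Real.cos (θ * ((n.1.valMinAbs * x + n.2.valMinAbs * y : ℤ) : ℝ))
          - Real.cos (θ * ((n.1.valMinAbs * x + n.2.valMinAbs * y + x : ℤ) : ℝ)) by ring]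
    refine (abs_cos_sub_cos_le_mul _ _).trans ?_
    set A : ℝ := ((n.1.valMinAbs * x + n.2.valMinAbs * y : ℤ) : ℝ) with hA
    have e1 : θ * A + θ * ((n.1.valMinAbs * x + n.2.valMinAbs * y + x : ℤ) : ℝ) = θ * (2 * A + x) := by
      rw [hA]; push_cast; ring
    have e2 : θ * A - θ * ((n.1.valMinAbs * x + n.2.valMinAbs * y + x : ℤ) : ℝ) = -(θ * x) := by
      rw [hA]; push_cast; ring
    rw [e1, e2, abs_neg, abs_mul, abs_mul, abs_of_pos hθpos]
    have hdot := dot_mul_le N n x y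
    rw [← hA] at hdot
    have h2A : |2 * A + (x : ℝ)| ≤ 2 * |A| + |(x : ℝ)| := by
      calc |2 * A + (x : ℝ)| ≤ |2 * A| + |(x : ℝ)| := abs_add_le _ _
        _ = 2 * |A| + |(x : ℝ)| := by rw [abs_mul, abs_two]
    have hx2 : |(x : ℝ)| * |(x : ℝ)| = (x : ℝ) ^ 2 := by rw [← sq, sq_abs]
    calc θ * |2 * A + (x : ℝ)| * (θ * |(x : ℝ)|) / 2 = θ ^ 2 * (|2 * A + (x : ℝ)| * |(x : ℝ)| / 2) := by ring
      _ ≤ θ ^ 2 * ((2 * |A| + |(x : ℝ)|) * |(x : ℝ)| / 2) := by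
          gcongr
      _ = θ ^ 2 * (|A| * |(x : ℝ)| + (x : ℝ) ^ 2 / 2) := by rw [← hx2]; ring
      _ ≤ θ ^ 2 * ((l1 N n + 1 / 2) * ((x : ℝ) ^ 2 + (y : ℝ) ^ 2)) := by gcongr
      _ = _ := by ring
  -- |Δv|
  have hdv : |2 * epsT N n - 2 * epsT N (n + ex N)| ≤ θ ^ 2 * (2 * l1 N n + 1) := by
    rw [epsT_eq_wInt, epsT_eq_wInt]
    have h2 : (n + ex N).2 = n.2 := by simp [ex]
    rw [h2]
    unfold wInt
    have hc : Real.cos (2 * Real.pi * (((n + ex N).1.valMinAbs : ℤ) : ℝ) / N)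
        = Real.cos (θ * ((n.1.valMinAbs + 1 : ℤ) : ℝ)) := by
      rw [show 2 * Real.pi * (((n + ex N).1.valMinAbs : ℤ) : ℝ) / N = 2 * Real.pi / N * (((n + ex N).1.valMinAbs : ℤ) : ℝ)
        by ring, cos_theta_congr N (rep_succ_congr N n), hθ]
    rw [hc, show 2 * Real.pi * ((n.1.valMinAbs : ℤ) : ℝ) / N = θ * ((n.1.valMinAbs : ℤ) : ℝ) by rw [hθ]; ring]
    set m : ℝ := ((n.1.valMinAbs : ℤ) : ℝ) with hm
    rw [show (2 * (1 - Real.cos (θ * m) + (1 - Real.cos (2 * Real.pi * ((n.2.valMinAbs : ℤ) : ℝ) / N)))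
        - 2 * (1 - Real.cos (θ * ((n.1.valMinAbs + 1 : ℤ) : ℝ))
          + (1 - Real.cos (2 * Real.pi * ((n.2.valMinAbs : ℤ) : ℝ) / N))))
        = 2 * (Real.cos (θ * ((n.1.valMinAbs + 1 : ℤ) : ℝ)) - Real.cos (θ * m)) by ring]
    rw [abs_mul, abs_two]
    refine (mul_le_mul_of_nonneg_left (abs_cos_sub_cos_le_mul _ _) (by norm_num)).trans ?_
    have e1 : θ * ((n.1.valMinAbs + 1 : ℤ) : ℝ) + θ * m = θ * (2 * m + 1) := by rw [hm]; push_cast; ring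
    have e2 : θ * ((n.1.valMinAbs + 1 : ℤ) : ℝ) - θ * m = θ := by rw [hm]; push_cast; ring
    rw [e1, e2, abs_mul, abs_of_pos hθpos]
    have hml : |m| ≤ l1 N n := by
      unfold l1; rw [hm]
      have := abs_nonneg ((n.2.valMinAbs : ℤ) : ℝ)
      linarith
    have : |2 * m + 1| ≤ 2 * l1 N n + 1 := by
      calc |2 * m + 1| ≤ |2 * m| + |1| := abs_add_le _ _
        _ = 2 * |m| + 1 := by rw [abs_mul, abs_two, abs_one]
        _ ≤ 2 * l1 N n + 1 := by linarith
    calc 2 * (θ * |2 * m + 1| * θ / 2) = θ ^ 2 * |2 * m + 1| := by ring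
      _ ≤ θ ^ 2 * (2 * l1 N n + 1) := by gcongr
  have hdv' : |2 * epsT N n - 2 * epsT N (n + ex N)| ≤ θ ^ 2 * (2 * l1 N n + 1) := hdv
  exact quotient_diff_bound (u := 1 - (phase N n r).re) (u' := 1 - (phase N (n + ex N) r).re)
    (v := 2 * epsT N n) (v' := 2 * epsT N (n + ex N)) (T := θ ^ 2) (c := 2 / Real.pi ^ 2)
    (a := l1 N n) (a' := l1 N (n + ex N)) (ρ := (x : ℝ) ^ 2 + (y : ℝ) ^ 2)
    (by positivity) (by positivity) (one_le_l1 N hn) (one_le_l1 N hn') (by positivity) hu0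
    (by rw [hθ]; linarith [hu]) hdu (by rw [hθ]; linarith [hv]) (by rw [hθ]; linarith [hv']) hdv'


/-! ## The `ℓ¹` ring count `Σ_{0 < |m|∞ ≤ K} 1/(|m₁| + |m₂|) ≤ 8K` -/

omit [NeZero N] in
/-- on the ring `puncturedBox (K+1) ∖ puncturedBox K` the `ℓ¹` norm is at least `K + 1`. [folklore] -/
theorem ring_l1_ge (K : ℕ) (m : ℤ × ℤ) (hm : m ∈ RateLemma.puncturedBox (K + 1) \ RateLemma.puncturedBox K) :
    ((K : ℝ) + 1) ≤ |(m.1 : ℝ)| + |(m.2 : ℝ)| := by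
  rw [Finset.mem_sdiff, RateLemma.mem_puncturedBox, RateLemma.mem_puncturedBox] at hm
  obtain ⟨⟨h0, ⟨h1, h2⟩, ⟨h3, h4⟩⟩, hn⟩ := hm
  push_cast at h1 h2 h3 h4 hn
  have key : ((K : ℤ) + 1) ≤ |m.1| + |m.2| := by
    by_cases ha : -(K : ℤ) ≤ m.1 ∧ m.1 ≤ K
    · have hb : ¬ (-(K : ℤ) ≤ m.2 ∧ m.2 ≤ K) := fun hb => hn ⟨h0, ha, hb⟩
      have : (K : ℤ) + 1 ≤ |m.2| := by rw [le_abs]; omega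
      linarith [abs_nonneg m.1]
    · have : (K : ℤ) + 1 ≤ |m.1| := by rw [le_abs]; omega
      linarith [abs_nonneg m.2]
  have : (((K : ℤ) + 1 : ℤ) : ℝ) ≤ ((|m.1| + |m.2| : ℤ) : ℝ) := by exact_mod_cast key
  push_cast at this
  simpa [Int.cast_abs] using this

omit [NeZero N] in
/-- ★ `Σ_{puncturedBox K} 1/(|m₁| + |m₂|) ≤ 8K` (each ring has `8j` points of `ℓ¹` norm `≥ j`). [folklore] -/
theorem sum_inv_l1_le (K : ℕ) :
    (∑ m ∈ RateLemma.puncturedBox K, 1 / (|(m.1 : ℝ)| + |(m.2 : ℝ)|)) ≤ 8 * (K : ℝ) := by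
  induction K with
  | zero =>
    have : RateLemma.puncturedBox 0 = ∅ := by decide
    simp [this]
  | succ K ih =>
    rw [← Finset.sum_sdiff (RateLemma.puncturedBox_mono K)]
    have hring : (∑ m ∈ RateLemma.puncturedBox (K + 1) \ RateLemma.puncturedBox K, 1 / (|(m.1 : ℝ)| + |(m.2 : ℝ)|)) ≤ 8 := by
      have hK1 : (0 : ℝ) < (K : ℝ) + 1 := by positivity
      have hle : ∀ m ∈ RateLemma.puncturedBox (K + 1) \ RateLemma.puncturedBox K,
          1 / (|(m.1 : ℝ)| + |(m.2 : ℝ)|) ≤ 1 / ((K : ℝ) + 1) := fun m hm =>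
        one_div_le_one_div_of_le hK1 (ring_l1_ge K m hm)
      have hcard : ((RateLemma.puncturedBox (K + 1) \ RateLemma.puncturedBox K).card : ℝ) = 8 * ((K : ℝ) + 1) := by
        rw [Finset.card_sdiff_of_subset (RateLemma.puncturedBox_mono K), RateLemma.card_puncturedBox,
          RateLemma.card_puncturedBox,
          show 4 * (K + 1) * (K + 1 + 1) = 8 * (K + 1) + 4 * K * (K + 1) by ring, Nat.add_sub_cancel]
        push_cast
        ring
      have h := Finset.sum_le_card_nsmul _ _ _ hle
      rw [nsmul_eq_mul, hcard] at h
      calc _ ≤ 8 * ((K : ℝ) + 1) * (1 / ((K : ℝ) + 1)) := h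
        _ = 8 := by field_simp
    push_cast
    linarith

/-! ## The summed first-difference bound -/

/-- `1/ℓ¹(n)` off the origin, `0` at the origin. [folklore] -/
def invl1 (n : Tor N) : ℝ := if n = 0 then 0 else 1 / l1 N n

omit [NeZero N] in
/-- `invl1 ≥ 0`. [folklore] -/
theorem invl1_nonneg (n : Tor N) : 0 ≤ invl1 N n := by
  unfold invl1; split_ifs
  · exact le_rfl
  · exact div_nonneg zero_le_one (l1_nonneg N n)

/-- ★ `Σ_n invl1(n) ≤ 4N` (representatives inject into the punctured box of half-width `⌊N/2⌋`). [folklore] -/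
theorem sum_invl1_le : ∑ n : Tor N, invl1 N n ≤ 4 * (N : ℝ) := by
  classical
  have hsplit : ∑ n : Tor N, invl1 N n = ∑ n ∈ Finset.univ.filter (fun n : Tor N => n ≠ 0), 1 / l1 N n := by
    rw [Finset.sum_filter]
    refine Finset.sum_congr rfl fun n _ => ?_
    unfold invl1
    by_cases h : n = 0 <;> simp [h]
  rw [hsplit]
  set rep : Tor N → ℤ × ℤ := fun k => (k.1.valMinAbs, k.2.valMinAbs) with hrep
  have hinj : Set.InjOn rep (Finset.univ.filter (fun n : Tor N => n ≠ 0) : Set (Tor N)) :=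
    fun a _ b _ h => RateLemma.rep_injective N h
  have himg : (Finset.univ.filter (fun n : Tor N => n ≠ 0)).image rep ⊆ RateLemma.puncturedBox (N / 2) := by
    intro m hm
    rw [Finset.mem_image] at hm
    obtain ⟨n, hn, rfl⟩ := hm
    rw [Finset.mem_filter] at hn
    unfold RateLemma.puncturedBox
    rw [Finset.mem_erase]
    refine ⟨?_, RateLemma.rep_mem_box N n⟩
    intro h
    apply hn.2
    simp only [hrep, Prod.mk.injEq] at h
    exact Prod.ext ((ZMod.valMinAbs_eq_zero _).mp h.1) ((ZMod.valMinAbs_eq_zero _).mp h.2)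
  have hsum : ∑ n ∈ Finset.univ.filter (fun n : Tor N => n ≠ 0), 1 / l1 N n
      = ∑ m ∈ (Finset.univ.filter (fun n : Tor N => n ≠ 0)).image rep, 1 / (|(m.1 : ℝ)| + |(m.2 : ℝ)|) := by
    rw [Finset.sum_image hinj]
    rfl
  rw [hsum]
  calc _ ≤ ∑ m ∈ RateLemma.puncturedBox (N / 2), 1 / (|(m.1 : ℝ)| + |(m.2 : ℝ)|) :=
        Finset.sum_le_sum_of_subset_of_nonneg himg fun m _ _ => by positivity
    _ ≤ 8 * ((N / 2 : ℕ) : ℝ) := sum_inv_l1_le (N / 2)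
    _ ≤ 4 * (N : ℝ) := by
        have : ((N / 2 : ℕ) : ℝ) ≤ (N : ℝ) / 2 := by
          have h := Nat.div_mul_le_self N 2
          have : ((N / 2 : ℕ) : ℝ) * 2 ≤ N := by exact_mod_cast h
          linarith
        linarith

/-- the value of `h_r` off the origin is at most `π²ρ/4`. [folklore] -/
theorem hfun_le (x y : ℤ) {n : Tor N} (hn : n ≠ 0) :
    0 ≤ hfun N (((x : ℤ) : ZMod N), ((y : ℤ) : ZMod N)) n ∧
    hfun N (((x : ℤ) : ZMod N), ((y : ℤ) : ZMod N)) n ≤ Real.pi ^ 2 / 4 * ((x : ℝ) ^ 2 + (y : ℝ) ^ 2) := by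
  rw [hfun_eq N hn]
  obtain ⟨hu0, hu⟩ := u_bounds N n x y
  have hv := two_epsT_ge_l1 N n
  have hvpos := two_epsT_pos N hn
  have ha := one_le_l1 N hn
  have hN : (0 : ℝ) < N := by exact_mod_cast Nat.pos_of_ne_zero (NeZero.ne N)
  refine ⟨div_nonneg hu0 hvpos.le, ?_⟩
  rw [div_le_iff₀ hvpos]
  have hθ : 0 < (2 * Real.pi / N) ^ 2 * l1 N n ^ 2 := by positivity
  -- u ≤ θ² a² ρ/2 and (π²/4) ρ · (2/π²) θ² a² = θ² a² ρ /2 ≤ (π²/4) ρ · 2ε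
  have : Real.pi ^ 2 / 4 * ((x : ℝ) ^ 2 + (y : ℝ) ^ 2) * (2 / Real.pi ^ 2 * (2 * Real.pi / N) ^ 2 * l1 N n ^ 2)
      = (2 * Real.pi / N) ^ 2 * l1 N n ^ 2 * ((x : ℝ) ^ 2 + (y : ℝ) ^ 2) / 2 := by
    field_simp
    ring
  have hρ : 0 ≤ Real.pi ^ 2 / 4 * ((x : ℝ) ^ 2 + (y : ℝ) ^ 2) := by positivity
  nlinarith [mul_le_mul_of_nonneg_left hv hρ]

/-- pointwise, with the edge cases folded in: `|Δh(n)| ≤ (5K/2)·ρ·invl1(n + eₓ) + (π²ρ/4)·[n = 0 ∨ n + eₓ = 0]`. [folklore] -/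
theorem abs_hfun_sub_le_all (x y : ℤ) (n : Tor N) :
    |hfun N (((x : ℤ) : ZMod N), ((y : ℤ) : ZMod N)) (n + ex N) - hfun N (((x : ℤ) : ZMod N), ((y : ℤ) : ZMod N)) n|
      ≤ 5 / 2 * (Real.pi ^ 2 / 2 + Real.pi ^ 4 / 4) * ((x : ℝ) ^ 2 + (y : ℝ) ^ 2) * invl1 N (n + ex N)
        + Real.pi ^ 2 / 4 * ((x : ℝ) ^ 2 + (y : ℝ) ^ 2) * (if (n = 0 ∨ n + ex N = 0) then 1 else 0) := by
  have hρ : 0 ≤ (x : ℝ) ^ 2 + (y : ℝ) ^ 2 := by positivity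
  have hK : 0 ≤ 5 / 2 * (Real.pi ^ 2 / 2 + Real.pi ^ 4 / 4) * ((x : ℝ) ^ 2 + (y : ℝ) ^ 2) * invl1 N (n + ex N) :=
    mul_nonneg (by positivity) (invl1_nonneg N _)
  have hB : 0 ≤ Real.pi ^ 2 / 4 * ((x : ℝ) ^ 2 + (y : ℝ) ^ 2) := by positivity
  by_cases h0 : n = 0
  · subst h0
    rw [hfun_zero, sub_zero, if_pos (Or.inl rfl), mul_one]
    by_cases he : (0 : Tor N) + ex N = 0
    · have hz : hfun N (((x : ℤ) : ZMod N), ((y : ℤ) : ZMod N)) ((0 : Tor N) + ex N) = 0 := by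
        rw [he]; exact hfun_zero N _
      rw [hz, abs_zero]
      linarith
    · obtain ⟨h1, h2⟩ := hfun_le N x y he
      rw [abs_of_nonneg h1]
      linarith
  by_cases he : n + ex N = 0
  · have h00 : invl1 N (n + ex N) = 0 := by rw [he]; simp [invl1]
    rw [he, hfun_zero, zero_sub, abs_neg, if_pos (Or.inr rfl), mul_one]
    rw [he] at h00
    rw [h00, mul_zero, zero_add]
    obtain ⟨h1, h2⟩ := hfun_le N x y h0
    rw [abs_of_nonneg h1]
    exact h2
  rw [if_neg (by tauto), mul_zero, add_zero]
  refine (abs_hfun_sub_le N x y h0 he).trans ?_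
  unfold invl1
  rw [if_neg he]
  have ha' := one_le_l1 N he
  obtain ⟨hle1, _⟩ := l1_succ_le N n
  -- (a + 1/2)/a'^2 ≤ (5/2)/a'
  have key : (l1 N n + 1 / 2) / l1 N (n + ex N) ^ 2 ≤ 5 / 2 * (1 / l1 N (n + ex N)) := by
    rw [div_le_iff₀ (by positivity)]
    have : 5 / 2 * (1 / l1 N (n + ex N)) * l1 N (n + ex N) ^ 2 = 5 / 2 * l1 N (n + ex N) := by
      field_simp
    rw [this]
    linarith
  have hKpos : 0 ≤ (Real.pi ^ 2 / 2 + Real.pi ^ 4 / 4) * ((x : ℝ) ^ 2 + (y : ℝ) ^ 2) := by positivity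
  calc (Real.pi ^ 2 / 2 + Real.pi ^ 4 / 4) * (((x : ℝ) ^ 2 + (y : ℝ) ^ 2) * (l1 N n + 1 / 2) / l1 N (n + ex N) ^ 2)
      = (Real.pi ^ 2 / 2 + Real.pi ^ 4 / 4) * ((x : ℝ) ^ 2 + (y : ℝ) ^ 2)
          * ((l1 N n + 1 / 2) / l1 N (n + ex N) ^ 2) := by ring
    _ ≤ (Real.pi ^ 2 / 2 + Real.pi ^ 4 / 4) * ((x : ℝ) ^ 2 + (y : ℝ) ^ 2) * (5 / 2 * (1 / l1 N (n + ex N))) :=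
        mul_le_mul_of_nonneg_left key hKpos
    _ = _ := by ring

/-- ★★ **THE SUMMED FIRST-DIFFERENCE BOUND** (`λ = 0`): `Σ_n |h_r(n + eₓ) − h_r(n)| ≤ (10K·N + π²/2)·ρ`,
`K = π²/2 + π⁴/4`, `ρ = x² + y²`. [folklore] -/
theorem sum_abs_hfun_sub_le (x y : ℤ) :
    ∑ n : Tor N, |hfun N (((x : ℤ) : ZMod N), ((y : ℤ) : ZMod N)) (n + ex N)
        - hfun N (((x : ℤ) : ZMod N), ((y : ℤ) : ZMod N)) n|
      ≤ (10 * (Real.pi ^ 2 / 2 + Real.pi ^ 4 / 4) * N + Real.pi ^ 2 / 2) * ((x : ℝ) ^ 2 + (y : ℝ) ^ 2) := by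
  classical
  refine (Finset.sum_le_sum fun n _ => abs_hfun_sub_le_all N x y n).trans ?_
  rw [Finset.sum_add_distrib, ← Finset.mul_sum, ← Finset.mul_sum]
  have h1 : ∑ n : Tor N, invl1 N (n + ex N) ≤ 4 * (N : ℝ) := by
    have hc := Equiv.sum_comp (Equiv.addRight (ex N)) (invl1 N)
    simp only [Equiv.coe_addRight] at hc
    rw [hc]
    exact sum_invl1_le N
  have h2 : ∑ n : Tor N, (if (n = 0 ∨ n + ex N = 0) then (1 : ℝ) else 0) ≤ 2 := by
    have hle : ∀ n : Tor N, (if (n = 0 ∨ n + ex N = 0) then (1 : ℝ) else 0)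
        ≤ (if n = 0 then (1 : ℝ) else 0) + (if n = -ex N then (1 : ℝ) else 0) := by
      intro n
      have hiff : n + ex N = 0 ↔ n = -ex N := by rw [add_eq_zero_iff_eq_neg]
      by_cases a : n = 0
      · by_cases b : n = -ex N
        · rw [if_pos (Or.inl a), if_pos a, if_pos b]; norm_num
        · rw [if_pos (Or.inl a), if_pos a, if_neg b]; norm_num
      · by_cases b : n = -ex N
        · rw [if_pos (Or.inr (hiff.mpr b)), if_neg a, if_pos b]; norm_num
        · have hn : ¬ (n = 0 ∨ n + ex N = 0) := by
            rintro (h | h)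
            · exact a h
            · exact b (hiff.mp h)
          rw [if_neg hn, if_neg a, if_neg b]; norm_num
    refine (Finset.sum_le_sum fun n _ => hle n).trans ?_
    rw [Finset.sum_add_distrib, Finset.sum_ite_eq', Finset.sum_ite_eq']
    simp only [Finset.mem_univ, if_true]
    norm_num
  have hρ : 0 ≤ (x : ℝ) ^ 2 + (y : ℝ) ^ 2 := by positivity
  have c1 : 0 ≤ 5 / 2 * (Real.pi ^ 2 / 2 + Real.pi ^ 4 / 4) * ((x : ℝ) ^ 2 + (y : ℝ) ^ 2) := by positivity
  have c2 : 0 ≤ Real.pi ^ 2 / 4 * ((x : ℝ) ^ 2 + (y : ℝ) ^ 2) := by positivity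
  nlinarith [mul_le_mul_of_nonneg_left h1 c1, mul_le_mul_of_nonneg_left h2 c2]

end Subsample

end Summit.HubbardSuperconductivity.HubbardSuperconductivity.Theorems.AnisotropyChord.Transfer.Fibre3

end
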